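import Literature.MathematicalPhysics.QuantumFieldTheory.Balaban1983to89.Node00.U3KernelLetters2
import Literature.MathematicalPhysics.QuantumFieldTheory.Balaban1983to89.Node00.U3OfKernelsChi

/-!
# NODE 00 ∕ W1 — NODE U3's KERNEL-INPUT LETTERS OF RECORD (W1-19b `U3KernelLetters` §2 + W1-19c `U3KernelLetters2` §2) RE-ISSUED GENERIC IN THE β-SLOT χ («Chi»)
# WITH THE RE-CENTRED («Ax») INSTANCES: `PolLimitsExistOfRecord₁₃Chi`, `WindowedNE9OfRecord₁₃Chi` (+ `…Forall…`), `WindowedDecayOfRecord₁₃Chi`, `GeometricIncrementsOfRecord₁₃Chi`,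
# `PolLimitsExistBoxOfRecord₁₃Chi`, `WindowedStepRateOfRecord₁₃Chi`, `KernelStepRateOfRecord₁₃Chi`, `WindowedDecayUniformOfRecord₁₃Chi` — each the parent's body VERBATIM with
# `chiβOfRecord₁₃ F N θ ↦ χ`, its `Iff.rfl` face, the receipt at `χ := chiβOfRecord₁₃ θ` (`Iff.rfl` with the parent), and the `…Ax` abbrev at `χ := chiβOfRecord₁₃Ax θ`

Cell `pub-ymgap` (YM-PLAN Track A, D-0062), width seat `pub-ymgap-dag-n07-w3` (g23).  WORK ORDER RC-1 (director-ym №462∕№467 (D)), op 5c supply (dag-lead g41 WORDS 626: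
«χ∕Ax twins of `Node00/U3KernelLetters{,2}` … carried to TABLE v137 row 07 ∕ l.K-spine as an UNOWNED op-5c supply piece»).  NEW sibling module — nothing of the parents
`Node00/U3KernelLetters` (node00-def-W1 g29) ∕ `Node00/U3KernelLetters2` (W1 g30) is edited (body-freeze); pattern of dag-n16-e g30's `Node00/U3OfKernelsChi` (✓p802930: [Ax-3b]∕[Ax-3c]
substitutions `chiβOfRecord₁₃ F N θ ↦ χ`, names `X ↦ XChi`, receipts at `χ := chiβOfRecord₁₃ θ`, Ax abbrevs at `χ := chiβOfRecord₁₃Ax θ`).  Definitions (binders) + `Iff.rfl` faces ONLY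
(statement-only lane); 0 `sorry` ∕ `instance` ∕ `notation`; nothing re-declared (the GENERIC letters `PolLimitsExist ∕ WindowedNE9 ∕ WindowedNE9Forall ∕ WindowedDecay ∕ GeometricIncrements ∕
PolLimitsExistBox ∕ WindowedStepRate ∕ KernelStepRate ∕ WindowedDecayUniform` and their transfers are the parents', cited by name).  [I] = [Balaban1987RG1]; [RG2] = [Balaban1988RG2Cluster].

WHY.  The parents' §2 record editions read the merged term family AT THE CHOICE-CENTRED cut-off `chiβOfRecord₁₃ θ`; the re-centred K-Ax items (K0ᴬ stmt-QuantumFields-27238,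
K1ᴬ -27239, K3ᴬ -27247; route rev 31–36) read `betaOfRecord₁₃Ax θ = betaOfRecord₁₃Chi θ (chiβOfRecord₁₃Ax θ)`, i.e. the kernels of `mergedTermFamilyMatT F N (TβOfRecord₁₃ F N)
(chiβOfRecord₁₃Ax F N θ) θ.εbg`.  Every Summits-side consumer of these letters that is to be re-keyed to the Ax record — the K0 box suppliers `…K0V23Stub3BoxSuppliers` §2 (two-letter
road `WindowedDecayUniformOfRecord₁₃` + `PolLimitsExistOfRecord₁₃` ⟹ box), `…K0V23Stub3FinVolSuppliers`, `…ActivitySlotSuppliers`, node N18's `…N18UniformDecayOfStepRate`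
(`WindowedStepRateOfRecord₁₃` + level-0 row ⟹ uniform windowed letter), (D4)'s `…D4KernelDecayOfWindowed`, DEF-1's `K0RecordFormatNamesLemmas6.recordPolLimitOnRunsAx_of_polLimitsExist`
(which today takes the GENERIC `PolLimitsExist` at the Ax term family for want of a named letter) — needs the letter keyed to the SAME cut-off its β reads.  This file supplies the names.

CONTENTS.  §1 (χ-generic, θ-level): the eight `…OfRecord₁₃Chi θ χ …` binders, their `Iff.rfl` faces (right-hand sides = the raw hypotheses the Summit-side producers display, with χ
for the cut-off), the receipts `…Chi_chiβ_iff` (at `χ := chiβOfRecord₁₃ θ` the χ-letter IS the parent's letter of record, `Iff.rfl`), — STATEMENT-ONLY (every body `Iff.rfl`); the parents' estimate-free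
convenience rows (`.box`, `.windowedNE9…`, `.windowedDecay…`, `.mono`, `_iff_forall_ne5`) are NOT re-issued: a consumer unfolds the face and applies the parents' GENERIC row
(`PolLimitsExist.box`, `WindowedNE9Forall.windowedNE9`, `WindowedDecayUniform.windowedDecay ∕ .mono`, `kernelStepRate_iff_forall_ne5`) at the χ term family; the link to W1-19's
χ-generic (5.10) clause is the Summit side's `le_of_tendsto` passage (`…D4KernelDecayOfWindowed.kernelDecay_of_windowed`, term-family generic).  §2: the RE-CENTRED instances `…OfRecord₁₃Ax θ … := …OfRecord₁₃Chi θ (chiβOfRecord₁₃Ax θ) …`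
(abbrevs) with their unfolded `Iff.rfl` faces over `mergedTermFamilyMatT F N (TβOfRecord₁₃ F N) (chiβOfRecord₁₃Ax F N θ) θ.εbg`.
NOT HERE: the READING-SIDE faces `…_iff_of_localizes` (they need a χ edition of W1-20's `Localizes17OfRecord₁₃`, not in the tree; W1 ∕ RR-2 lane).

HONEST LIMITS.  Binders (`Prop`-valued definitions) and `Iff.rfl` faces ONLY.  No letter is inhabited here; no passage theorem; no estimate of print is proved or
asserted — the windowed bounds are the CONTENT of [I] §1 ∕ §5 ((1.18), (5.10)) carried through the cluster expansion, and (1.21)'s existence is a theorem of [I]–[III] typed elsewhere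
as a displayed property (`Node00.PolLimitExists`).  Count-neutral; no node of the record is discharged; K0ᴬ ∕ K1ᴬ ∕ K3ᴬ OPEN, untouched; one finite-torus programme at fixed lattice
spacing — nothing continuum, nothing OS, nothing about a mass gap: the Yang–Mills mass gap (Clay) is NOT proved by any of this.

## CITATION HEADER (D-0065)
- [I] = T. Bałaban, Renormalization group approach to lattice gauge field theories. I., Comm. Math. Phys. 109 (1987) 249–301 [Balaban1987RG1]: Thm 1 p. 259; (1.18) p. 263;
  (1.20)–(1.21) p. 264 «uniformly bounded on the domain (1.19) together with all derivatives … This limit exists by the localized representation (1.7)»; (2.9) p. 266 (the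
  fluctuation cut-off whose centre the χ-slot carries); (5.10) p. 293.
- [RG2] = T. Bałaban, Renormalization group approach to lattice gauge field theories. II. Cluster expansions, Comm. Math. Phys. 116 (1988) 1–22 [Balaban1988RG2Cluster]:
  (2.13)–(2.14) pp. 14–15.

Typer lint: no `instance`, no `notation`, no attribute removal, no `sorry`; imports `Node00.U3KernelLetters2` (⊇ `U3KernelLetters`, `LocalizedSum17`, `U3OfKernels`) and
`Node00.U3OfKernelsChi` (⊇ `Record13Chi` ⊇ `Record13Ax`: `ChiSlot`, `chiβOfRecord₁₃Ax`, `KernelDecayOfRecord₁₃Chi`) only.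
-/

open scoped BigOperators

noncomputable section

namespace Literature.MathematicalPhysics.QuantumFieldTheory.Balaban1983to89.Node00.U3KernelLetters

open Filter
open T4Continuum (T4Family)
open T4OutputRate (Window)
open B12Sec2to5 (l1)
open FlowStep (Box)
open U3OfKernels (histPrefix kernelA)
open U3KernelLetters2 (WindowedDecayUniform WindowedDecayUniformOfRecord₁₃)

/-! ## §1. The letters at the record, Stage 13, β-SLOT χ -/

section RecordChi

open scoped Matrix.Norms.L2Operator

variable (F : T4Family) (N : ℕ) [NeZero N]

/-- **(1.21) EXISTS ON THE WINDOW OF RECORD, β-slot χ** (binder): the parent's `PolLimitsExistOfRecord₁₃` with the merged term family read at the cut-off `χ`.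
[cite: Balaban1987RG1, (1.21) p.264, (2.9) p.266] -/
def PolLimitsExistOfRecord₁₃Chi (θ : Stage13Params F N) (χ : ChiSlot F N) : Prop :=
  letI := θ.instVβ₁; letI := θ.instVβ₂; letI := θ.instιβ
  PolLimitsExist F (mergedTermFamilyMatT F N (TβOfRecord₁₃ F N) χ θ.εbg) θ.ρ8 θ.bV (Window θ.γ)

/-- Face (`Iff.rfl`). [cite: Balaban1987RG1, (1.21) p.264 (bookkeeping)] -/
theorem polLimitsExistOfRecord₁₃Chi_iff (θ : Stage13Params F N) (χ : ChiSlot F N) :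
    PolLimitsExistOfRecord₁₃Chi F N θ χ ↔
      (letI := θ.instVβ₁; letI := θ.instVβ₂; letI := θ.instιβ
       ∀ g ∈ Window θ.γ, ∀ j : ℕ,
        PolLimitExists F (j + 1) (fun K => mergedTermFamilyMatT F N (TβOfRecord₁₃ F N) χ θ.εbg j (histPrefix g j) K) θ.ρ8 θ.bV) :=
  Iff.rfl

/-- Receipt: at the record's β-slot the χ-letter IS the letter of record (`Iff.rfl`). [cite: Balaban1987RG1, (1.21) p.264 (bookkeeping)] -/
theorem polLimitsExistOfRecord₁₃Chi_chiβ_iff (θ : Stage13Params F N) :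
    PolLimitsExistOfRecord₁₃Chi F N θ (chiβOfRecord₁₃ F N θ) ↔ PolLimitsExistOfRecord₁₃ F N θ := Iff.rfl

/-- **WINDOWED NE9 OF RECORD, β-slot χ** at rate `κ` and moduli `Λ` (binder). [cite: Balaban1987RG1, (1.18) p.263 and (1.20) p.264, (2.9) p.266] -/
def WindowedNE9OfRecord₁₃Chi (θ : Stage13Params F N) (χ : ChiSlot F N) (κ : ℝ) (Λ : ℕ → ℕ → ℝ) : Prop :=
  letI := θ.instVβ₁; letI := θ.instVβ₂; letI := θ.instιβ
  WindowedNE9 F (mergedTermFamilyMatT F N (TβOfRecord₁₃ F N) χ θ.εbg) θ.ρ8 θ.bV (Window θ.γ) κ Λ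

/-- Face (`Iff.rfl`). [cite: Balaban1987RG1, (1.18) p.263 (bookkeeping)] -/
theorem windowedNE9OfRecord₁₃Chi_iff (θ : Stage13Params F N) (χ : ChiSlot F N) (κ : ℝ) (Λ : ℕ → ℕ → ℝ) :
    WindowedNE9OfRecord₁₃Chi F N θ χ κ Λ ↔
      (letI := θ.instVβ₁; letI := θ.instVβ₂; letI := θ.instιβ
       ∀ g ∈ Window θ.γ, ∀ g' ∈ Window θ.γ, ∀ (j : ℕ) (μ ν : Fin 4) (z : Fin 4 → ℤ), ∀ᶠ K in atTop,
        |polWindow F K (j + 1) (mergedTermFamilyMatT F N (TβOfRecord₁₃ F N) χ θ.εbg j (histPrefix g j) K) θ.ρ8 θ.bV μ ν z -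
            polWindow F K (j + 1) (mergedTermFamilyMatT F N (TβOfRecord₁₃ F N) χ θ.εbg j (histPrefix g' j) K) θ.ρ8 θ.bV μ ν z| ≤
          Real.exp (-(κ * l1 z)) * ∑ i ∈ Finset.range (j + 1), Λ (j + 1) i * |g i - g' i|) :=
  Iff.rfl

/-- Receipt at `χ := chiβOfRecord₁₃ θ` (`Iff.rfl`). [cite: Balaban1987RG1, (1.18) p.263 (bookkeeping)] -/
theorem windowedNE9OfRecord₁₃Chi_chiβ_iff (θ : Stage13Params F N) (κ : ℝ) (Λ : ℕ → ℕ → ℝ) :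
    WindowedNE9OfRecord₁₃Chi F N θ (chiβOfRecord₁₃ F N θ) κ Λ ↔ WindowedNE9OfRecord₁₃ F N θ κ Λ := Iff.rfl

/-- The `∀ K` form of windowed NE9 of record, β-slot χ (binder). [cite: Balaban1987RG1, (1.18) p.263 and (1.20) p.264] -/
def WindowedNE9ForallOfRecord₁₃Chi (θ : Stage13Params F N) (χ : ChiSlot F N) (κ : ℝ) (Λ : ℕ → ℕ → ℝ) : Prop :=
  letI := θ.instVβ₁; letI := θ.instVβ₂; letI := θ.instιβ
  WindowedNE9Forall F (mergedTermFamilyMatT F N (TβOfRecord₁₃ F N) χ θ.εbg) θ.ρ8 θ.bV (Window θ.γ) κ Λ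

/-- Receipt at `χ := chiβOfRecord₁₃ θ` (`Iff.rfl`). [cite: Balaban1987RG1, (1.18) p.263 (bookkeeping)] -/
theorem windowedNE9ForallOfRecord₁₃Chi_chiβ_iff (θ : Stage13Params F N) (κ : ℝ) (Λ : ℕ → ℕ → ℝ) :
    WindowedNE9ForallOfRecord₁₃Chi F N θ (chiβOfRecord₁₃ F N θ) κ Λ ↔ WindowedNE9ForallOfRecord₁₃ F N θ κ Λ := Iff.rfl

/-- **WINDOWED (5.10) DECAY OF RECORD, β-slot χ** at directions `(μ, ν)` and rate `κ` (binder). [cite: Balaban1987RG1, (5.10) p.293 and (1.20) p.264, (2.9) p.266] -/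
def WindowedDecayOfRecord₁₃Chi (θ : Stage13Params F N) (χ : ChiSlot F N) (μ ν : Fin 4) (κ : ℝ) : Prop :=
  letI := θ.instVβ₁; letI := θ.instVβ₂; letI := θ.instιβ
  WindowedDecay F (mergedTermFamilyMatT F N (TβOfRecord₁₃ F N) χ θ.εbg) θ.ρ8 θ.bV (Window θ.γ) μ ν κ

/-- Face (`Iff.rfl`). [cite: Balaban1987RG1, (5.10) p.293 (bookkeeping)] -/
theorem windowedDecayOfRecord₁₃Chi_iff (θ : Stage13Params F N) (χ : ChiSlot F N) (μ ν : Fin 4) (κ : ℝ) :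
    WindowedDecayOfRecord₁₃Chi F N θ χ μ ν κ ↔
      (letI := θ.instVβ₁; letI := θ.instVβ₂; letI := θ.instιβ
       ∀ g ∈ Window θ.γ, ∃ C₀ : ℝ, ∀ (j : ℕ) (z : Fin 4 → ℤ), ∀ᶠ K in atTop,
        |polWindow F K (j + 1) (mergedTermFamilyMatT F N (TβOfRecord₁₃ F N) χ θ.εbg j (histPrefix g j) K) θ.ρ8 θ.bV μ ν z| ≤
          C₀ * Real.exp (-κ * l1 z)) :=
  Iff.rfl

/-- Receipt at `χ := chiβOfRecord₁₃ θ` (`Iff.rfl`). [cite: Balaban1987RG1, (5.10) p.293 (bookkeeping)] -/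
theorem windowedDecayOfRecord₁₃Chi_chiβ_iff (θ : Stage13Params F N) (μ ν : Fin 4) (κ : ℝ) :
    WindowedDecayOfRecord₁₃Chi F N θ (chiβOfRecord₁₃ F N θ) μ ν κ ↔ WindowedDecayOfRecord₁₃ F N θ μ ν κ := Iff.rfl

/-- **GEOMETRIC INCREMENTS OF RECORD, β-slot χ** at ratio `r` (binder). [cite: Balaban1987RG1, (1.21) p.264, (2.9) p.266] -/
def GeometricIncrementsOfRecord₁₃Chi (θ : Stage13Params F N) (χ : ChiSlot F N) (r : ℝ) : Prop :=
  letI := θ.instVβ₁; letI := θ.instVβ₂; letI := θ.instιβ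
  GeometricIncrements F (mergedTermFamilyMatT F N (TβOfRecord₁₃ F N) χ θ.εbg) θ.ρ8 θ.bV (Window θ.γ) r

/-- Face (`Iff.rfl`). [cite: Balaban1987RG1, (1.21) p.264 (bookkeeping)] -/
theorem geometricIncrementsOfRecord₁₃Chi_iff (θ : Stage13Params F N) (χ : ChiSlot F N) (r : ℝ) :
    GeometricIncrementsOfRecord₁₃Chi F N θ χ r ↔
      (letI := θ.instVβ₁; letI := θ.instVβ₂; letI := θ.instιβ
       ∀ g ∈ Window θ.γ, ∀ (j : ℕ) (μ ν : Fin 4) (z : Fin 4 → ℤ), ∃ (K₀ : ℕ) (C : ℝ), ∀ K ≥ K₀,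
        |polWindow F (K + 1) (j + 1) (mergedTermFamilyMatT F N (TβOfRecord₁₃ F N) χ θ.εbg j (histPrefix g j) (K + 1)) θ.ρ8 θ.bV μ ν z -
            polWindow F K (j + 1) (mergedTermFamilyMatT F N (TβOfRecord₁₃ F N) χ θ.εbg j (histPrefix g j) K) θ.ρ8 θ.bV μ ν z| ≤ C * r ^ K) :=
  Iff.rfl

/-- Receipt at `χ := chiβOfRecord₁₃ θ` (`Iff.rfl`). [cite: Balaban1987RG1, (1.21) p.264 (bookkeeping)] -/
theorem geometricIncrementsOfRecord₁₃Chi_chiβ_iff (θ : Stage13Params F N) (r : ℝ) :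
    GeometricIncrementsOfRecord₁₃Chi F N θ (chiβOfRecord₁₃ F N θ) r ↔ GeometricIncrementsOfRecord₁₃ F N θ r := Iff.rfl

/-- **(1.21) EXISTS ON THE BOXES OF RECORD, β-slot χ** (binder, box form). [cite: Balaban1987RG1, (1.21) p.264, (2.9) p.266] -/
def PolLimitsExistBoxOfRecord₁₃Chi (θ : Stage13Params F N) (χ : ChiSlot F N) : Prop :=
  letI := θ.instVβ₁; letI := θ.instVβ₂; letI := θ.instιβ
  PolLimitsExistBox F (mergedTermFamilyMatT F N (TβOfRecord₁₃ F N) χ θ.εbg) θ.ρ8 θ.bV θ.γ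

/-- Face (`Iff.rfl`). [cite: Balaban1987RG1, (1.21) p.264 (bookkeeping)] -/
theorem polLimitsExistBoxOfRecord₁₃Chi_iff (θ : Stage13Params F N) (χ : ChiSlot F N) :
    PolLimitsExistBoxOfRecord₁₃Chi F N θ χ ↔
      (letI := θ.instVβ₁; letI := θ.instVβ₂; letI := θ.instιβ
       ∀ (k : ℕ) (v : Fin (k + 1) → ℝ), v ∈ Box θ.γ k →
        PolLimitExists F (k + 1) (fun K => mergedTermFamilyMatT F N (TβOfRecord₁₃ F N) χ θ.εbg k v K) θ.ρ8 θ.bV) :=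
  Iff.rfl

/-- Receipt at `χ := chiβOfRecord₁₃ θ` (`Iff.rfl`). [cite: Balaban1987RG1, (1.21) p.264 (bookkeeping)] -/
theorem polLimitsExistBoxOfRecord₁₃Chi_chiβ_iff (θ : Stage13Params F N) :
    PolLimitsExistBoxOfRecord₁₃Chi F N θ (chiβOfRecord₁₃ F N θ) ↔ PolLimitsExistBoxOfRecord₁₃ F N θ := Iff.rfl

/-- **WINDOWED TWO-RUN STEP RATE OF RECORD, β-slot χ** (binder; run offset `s`, rate `κ`, ratio `θ₅`, constant `C'`). [cite: Balaban1987RG1, Thm 1 p.259 and (1.20)–(1.21) p.264, (2.9) p.266] -/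
def WindowedStepRateOfRecord₁₃Chi (θ : Stage13Params F N) (χ : ChiSlot F N) (s : ℕ) (κ θ₅ C' : ℝ) : Prop :=
  letI := θ.instVβ₁; letI := θ.instVβ₂; letI := θ.instιβ
  WindowedStepRate F (mergedTermFamilyMatT F N (TβOfRecord₁₃ F N) χ θ.εbg) θ.ρ8 θ.bV θ.γ s κ θ₅ C'

/-- Face (`Iff.rfl`). [cite: Balaban1987RG1, Thm 1 p.259 (bookkeeping)] -/
theorem windowedStepRateOfRecord₁₃Chi_iff (θ : Stage13Params F N) (χ : ChiSlot F N) (s : ℕ) (κ θ₅ C' : ℝ) :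
    WindowedStepRateOfRecord₁₃Chi F N θ χ s κ θ₅ C' ↔
      (letI := θ.instVβ₁; letI := θ.instVβ₂; letI := θ.instιβ
       ∀ (k : ℕ) (w : Fin (k + 2) → ℝ), w ∈ Box θ.γ (k + 1) → ∀ (μ ν : Fin 4) (x : Fin 4 → ℤ), ∀ᶠ K in atTop,
        |polWindow F (K + s) (k + 1 + 1) (mergedTermFamilyMatT F N (TβOfRecord₁₃ F N) χ θ.εbg (k + 1) w (K + s)) θ.ρ8 θ.bV μ ν x -
            polWindow F K (k + 1) (mergedTermFamilyMatT F N (TβOfRecord₁₃ F N) χ θ.εbg k (Fin.tail w) K) θ.ρ8 θ.bV μ ν x| ≤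
          C' * θ₅ ^ k * Real.exp (-κ * l1 x)) :=
  Iff.rfl

/-- Receipt at `χ := chiβOfRecord₁₃ θ` (`Iff.rfl`). [cite: Balaban1987RG1, Thm 1 p.259 (bookkeeping)] -/
theorem windowedStepRateOfRecord₁₃Chi_chiβ_iff (θ : Stage13Params F N) (s : ℕ) (κ θ₅ C' : ℝ) :
    WindowedStepRateOfRecord₁₃Chi F N θ (chiβOfRecord₁₃ F N θ) s κ θ₅ C' ↔ WindowedStepRateOfRecord₁₃ F N θ s κ θ₅ C' := Iff.rfl

/-- **KERNEL STEP RATE OF RECORD, β-slot χ** (binder, limiting kernels; rate `κ`, ratio `θ₅`, constant `C₅`). [cite: Balaban1987RG1, Thm 1 p.259 and (1.20)–(1.22) p.264, (2.9) p.266] -/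
def KernelStepRateOfRecord₁₃Chi (θ : Stage13Params F N) (χ : ChiSlot F N) (κ θ₅ C₅ : ℝ) : Prop :=
  letI := θ.instVβ₁; letI := θ.instVβ₂; letI := θ.instιβ
  KernelStepRate F (mergedTermFamilyMatT F N (TβOfRecord₁₃ F N) χ θ.εbg) θ.ρ8 θ.bV θ.γ κ θ₅ C₅

/-- Face (`Iff.rfl`). [cite: Balaban1987RG1, Thm 1 p.259 (bookkeeping)] -/
theorem kernelStepRateOfRecord₁₃Chi_iff (θ : Stage13Params F N) (χ : ChiSlot F N) (κ θ₅ C₅ : ℝ) :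
    KernelStepRateOfRecord₁₃Chi F N θ χ κ θ₅ C₅ ↔
      (letI := θ.instVβ₁; letI := θ.instVβ₂; letI := θ.instιβ
       ∀ b : ℝ, 0 < b → b ≤ θ.γ → ∀ g ∈ Window θ.γ, ∀ (j : ℕ) (μ ν : Fin 4) (z : Fin 4 → ℤ),
        |kernelA F (mergedTermFamilyMatT F N (TβOfRecord₁₃ F N) χ θ.εbg) θ.ρ8 θ.bV g j μ ν z -
            kernelA F (mergedTermFamilyMatT F N (TβOfRecord₁₃ F N) χ θ.εbg) θ.ρ8 θ.bV (prependCoupling b g) (j + 1) μ ν z| ≤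
          C₅ * θ₅ ^ (j + 1) * Real.exp (-(κ * l1 z))) :=
  Iff.rfl

/-- Receipt at `χ := chiβOfRecord₁₃ θ` (`Iff.rfl`). [cite: Balaban1987RG1, Thm 1 p.259 (bookkeeping)] -/
theorem kernelStepRateOfRecord₁₃Chi_chiβ_iff (θ : Stage13Params F N) (κ θ₅ C₅ : ℝ) :
    KernelStepRateOfRecord₁₃Chi F N θ (chiβOfRecord₁₃ F N θ) κ θ₅ C₅ ↔ KernelStepRateOfRecord₁₃ F N θ κ θ₅ C₅ := Iff.rfl

/-- **UNIFORM WINDOWED (5.10) DECAY OF RECORD, β-slot χ** with constant `E₀` and rate `δ` (binder; W1-19c's letter at the cut-off `χ`).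
[cite: Balaban1987RG1, (5.10) p.293, Thm 1 p.259 and (1.20) p.264, (2.9) p.266] -/
def WindowedDecayUniformOfRecord₁₃Chi (θ : Stage13Params F N) (χ : ChiSlot F N) (E₀ δ : ℝ) : Prop :=
  letI := θ.instVβ₁; letI := θ.instVβ₂; letI := θ.instιβ
  WindowedDecayUniform F (mergedTermFamilyMatT F N (TβOfRecord₁₃ F N) χ θ.εbg) θ.ρ8 θ.bV (Window θ.γ) E₀ δ

/-- Face (`Iff.rfl`). [cite: Balaban1987RG1, (5.10) p.293 (bookkeeping)] -/
theorem windowedDecayUniformOfRecord₁₃Chi_iff (θ : Stage13Params F N) (χ : ChiSlot F N) (E₀ δ : ℝ) :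
    WindowedDecayUniformOfRecord₁₃Chi F N θ χ E₀ δ ↔
      (letI := θ.instVβ₁; letI := θ.instVβ₂; letI := θ.instιβ
       ∀ g ∈ Window θ.γ, ∀ (k : ℕ) (μ ν : Fin 4) (z : Fin 4 → ℤ), ∀ᶠ K in atTop,
        |polWindow F K (k + 1) (mergedTermFamilyMatT F N (TβOfRecord₁₃ F N) χ θ.εbg k (histPrefix g k) K) θ.ρ8 θ.bV μ ν z| ≤
          E₀ * Real.exp (-δ * l1 z)) :=
  Iff.rfl

/-- Receipt at `χ := chiβOfRecord₁₃ θ` (`Iff.rfl`). [cite: Balaban1987RG1, (5.10) p.293 (bookkeeping)] -/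
theorem windowedDecayUniformOfRecord₁₃Chi_chiβ_iff (θ : Stage13Params F N) (E₀ δ : ℝ) :
    WindowedDecayUniformOfRecord₁₃Chi F N θ (chiβOfRecord₁₃ F N θ) E₀ δ ↔ WindowedDecayUniformOfRecord₁₃ F N θ E₀ δ := Iff.rfl

end RecordChi

/-! ## §2. The RE-CENTRED instances (`χ := chiβOfRecord₁₃Ax θ`): the letters keyed to the SAME cut-off `betaOfRecord₁₃Ax θ` reads -/

section RecordAx

open scoped Matrix.Norms.L2Operator

variable (F : T4Family) (N : ℕ) [NeZero N]

/-- **(1.21) exists on the window of the RE-CENTRED record** (binder). [cite: Balaban1987RG1, (1.21) p.264, (2.9) p.266] -/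
abbrev PolLimitsExistOfRecord₁₃Ax (θ : Stage13Params F N) : Prop := PolLimitsExistOfRecord₁₃Chi F N θ (chiβOfRecord₁₃Ax F N θ)

/-- Face (`Iff.rfl`): the re-centred letter IS the GENERIC `PolLimitsExist` at the re-centred merged term family — the hypothesis of DEF-1's
`K0RecordFormatNamesLemmas6.recordPolLimitOnRunsAx_of_polLimitsExist` read at a general `θ`. [cite: Balaban1987RG1, (1.21) p.264 (bookkeeping)] -/
theorem polLimitsExistOfRecord₁₃Ax_iff (θ : Stage13Params F N) :
    PolLimitsExistOfRecord₁₃Ax F N θ ↔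
      (letI := θ.instVβ₁; letI := θ.instVβ₂; letI := θ.instιβ
       PolLimitsExist F (mergedTermFamilyMatT F N (TβOfRecord₁₃ F N) (chiβOfRecord₁₃Ax F N θ) θ.εbg) θ.ρ8 θ.bV (Window θ.γ)) :=
  Iff.rfl

/-- **Windowed NE9 of the RE-CENTRED record** (binder). [cite: Balaban1987RG1, (1.18) p.263, (2.9) p.266] -/
abbrev WindowedNE9OfRecord₁₃Ax (θ : Stage13Params F N) (κ : ℝ) (Λ : ℕ → ℕ → ℝ) : Prop := WindowedNE9OfRecord₁₃Chi F N θ (chiβOfRecord₁₃Ax F N θ) κ Λ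

/-- **Windowed NE9 of the RE-CENTRED record, `∀ K` form** (binder). [cite: Balaban1987RG1, (1.18) p.263, (2.9) p.266] -/
abbrev WindowedNE9ForallOfRecord₁₃Ax (θ : Stage13Params F N) (κ : ℝ) (Λ : ℕ → ℕ → ℝ) : Prop :=
  WindowedNE9ForallOfRecord₁₃Chi F N θ (chiβOfRecord₁₃Ax F N θ) κ Λ

/-- **Windowed (5.10) decay of the RE-CENTRED record** (binder). [cite: Balaban1987RG1, (5.10) p.293, (2.9) p.266] -/
abbrev WindowedDecayOfRecord₁₃Ax (θ : Stage13Params F N) (μ ν : Fin 4) (κ : ℝ) : Prop := WindowedDecayOfRecord₁₃Chi F N θ (chiβOfRecord₁₃Ax F N θ) μ ν κ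

/-- **Geometric increments of the RE-CENTRED record** (binder). [cite: Balaban1987RG1, (1.21) p.264, (2.9) p.266] -/
abbrev GeometricIncrementsOfRecord₁₃Ax (θ : Stage13Params F N) (r : ℝ) : Prop := GeometricIncrementsOfRecord₁₃Chi F N θ (chiβOfRecord₁₃Ax F N θ) r

/-- **(1.21) exists on the boxes of the RE-CENTRED record** (binder). [cite: Balaban1987RG1, (1.21) p.264, (2.9) p.266] -/
abbrev PolLimitsExistBoxOfRecord₁₃Ax (θ : Stage13Params F N) : Prop := PolLimitsExistBoxOfRecord₁₃Chi F N θ (chiβOfRecord₁₃Ax F N θ)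

/-- **Windowed two-run step rate of the RE-CENTRED record** (binder). [cite: Balaban1987RG1, Thm 1 p.259, (2.9) p.266] -/
abbrev WindowedStepRateOfRecord₁₃Ax (θ : Stage13Params F N) (s : ℕ) (κ θ₅ C' : ℝ) : Prop :=
  WindowedStepRateOfRecord₁₃Chi F N θ (chiβOfRecord₁₃Ax F N θ) s κ θ₅ C'

/-- **Kernel step rate of the RE-CENTRED record** (binder). [cite: Balaban1987RG1, Thm 1 p.259, (2.9) p.266] -/
abbrev KernelStepRateOfRecord₁₃Ax (θ : Stage13Params F N) (κ θ₅ C₅ : ℝ) : Prop := KernelStepRateOfRecord₁₃Chi F N θ (chiβOfRecord₁₃Ax F N θ) κ θ₅ C₅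

/-- **Uniform windowed (5.10) decay of the RE-CENTRED record** (binder). [cite: Balaban1987RG1, (5.10) p.293, (2.9) p.266] -/
abbrev WindowedDecayUniformOfRecord₁₃Ax (θ : Stage13Params F N) (E₀ δ : ℝ) : Prop := WindowedDecayUniformOfRecord₁₃Chi F N θ (chiβOfRecord₁₃Ax F N θ) E₀ δ

/-- Face (`Iff.rfl`): the re-centred uniform letter IS the GENERIC `WindowedDecayUniform` at the re-centred merged term family.
[cite: Balaban1987RG1, (5.10) p.293 (bookkeeping)] -/
theorem windowedDecayUniformOfRecord₁₃Ax_iff (θ : Stage13Params F N) (E₀ δ : ℝ) :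
    WindowedDecayUniformOfRecord₁₃Ax F N θ E₀ δ ↔
      (letI := θ.instVβ₁; letI := θ.instVβ₂; letI := θ.instιβ
       WindowedDecayUniform F (mergedTermFamilyMatT F N (TβOfRecord₁₃ F N) (chiβOfRecord₁₃Ax F N θ) θ.εbg) θ.ρ8 θ.bV (Window θ.γ) E₀ δ) :=
  Iff.rfl

/-- Face (`Iff.rfl`): the re-centred step-rate letter IS the GENERIC `WindowedStepRate` at the re-centred merged term family (node N18's producer input).
[cite: Balaban1987RG1, Thm 1 p.259 (bookkeeping)] -/
theorem windowedStepRateOfRecord₁₃Ax_iff (θ : Stage13Params F N) (s : ℕ) (κ θ₅ C' : ℝ) :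
    WindowedStepRateOfRecord₁₃Ax F N θ s κ θ₅ C' ↔
      (letI := θ.instVβ₁; letI := θ.instVβ₂; letI := θ.instιβ
       WindowedStepRate F (mergedTermFamilyMatT F N (TβOfRecord₁₃ F N) (chiβOfRecord₁₃Ax F N θ) θ.εbg) θ.ρ8 θ.bV θ.γ s κ θ₅ C') :=
  Iff.rfl

/-- Face (`Iff.rfl`): the re-centred windowed NE9 letter IS the GENERIC `WindowedNE9` at the re-centred merged term family (node N22's producer input).
[cite: Balaban1987RG1, (1.18) p.263 (bookkeeping)] -/
theorem windowedNE9OfRecord₁₃Ax_iff (θ : Stage13Params F N) (κ : ℝ) (Λ : ℕ → ℕ → ℝ) :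
    WindowedNE9OfRecord₁₃Ax F N θ κ Λ ↔
      (letI := θ.instVβ₁; letI := θ.instVβ₂; letI := θ.instιβ
       WindowedNE9 F (mergedTermFamilyMatT F N (TβOfRecord₁₃ F N) (chiβOfRecord₁₃Ax F N θ) θ.εbg) θ.ρ8 θ.bV (Window θ.γ) κ Λ) :=
  Iff.rfl

/-- Face (`Iff.rfl`): the re-centred windowed (5.10) letter IS the GENERIC `WindowedDecay` at the re-centred merged term family ((D4)'s producer input).
[cite: Balaban1987RG1, (5.10) p.293 (bookkeeping)] -/
theorem windowedDecayOfRecord₁₃Ax_iff (θ : Stage13Params F N) (μ ν : Fin 4) (κ : ℝ) :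
    WindowedDecayOfRecord₁₃Ax F N θ μ ν κ ↔
      (letI := θ.instVβ₁; letI := θ.instVβ₂; letI := θ.instιβ
       WindowedDecay F (mergedTermFamilyMatT F N (TβOfRecord₁₃ F N) (chiβOfRecord₁₃Ax F N θ) θ.εbg) θ.ρ8 θ.bV (Window θ.γ) μ ν κ) :=
  Iff.rfl

end RecordAx

end Literature.MathematicalPhysics.QuantumFieldTheory.Balaban1983to89.Node00.U3KernelLetters

end
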